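import Summits.Ventures.HodgeRepro2.T5SU11ReductionOfOrderInfinity
import Summits.Ventures.HodgeRepro2.T5SU11SphericalSolutionSpaceAll

/-!
# The decaying spherical solution for `λ > 1`: `χ_λ(t) = φ_λ(a_t) ∫_t^∞ ds/(sinh 2s φ_λ(a_s)²)`, and `Q_n(cosh 2t) = 2 χ_{2n+2}(t)`

For `λ > 1` the spherical function grows like `c(2 − λ) e^{(λ−2)t}` (row 334's `tendsto_exp_two_sub_mul_sph_hyp`,
`c(2 − λ) > 0` by row 336's `cfun_pos`), and `sinh 2t ≥ e^{2t}/4` for `t ≥ 1` (`exp_div_four_le_sinh`), so the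
reduction-of-order integrand `1/(sinh 2s φ_λ(a_s)²)` is eventually bounded by `(16/c²) e^{−2(λ−1)s}` and is
INTEGRABLE AT INFINITY (`integrableOn_roIntegrand_sph`). Row 447 then gives, for every `λ > 1`,

  **`χ_λ(t) := φ_λ(a_t) · ∫_t^∞ ds/(sinh 2s · φ_λ(a_s)²)`**  (`sphDecay`),

a POSITIVE solution of the radial equation on `(0, ∞)` (`sphDecay_pos`, `sphDecay_ode`) with
`sinh 2t · (φ_λ χ_λ′ − φ_λ′ χ_λ) = −1` (`wronskian_sphDecay`) and **`χ_λ/φ_λ → 0` at infinity**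
(`tendsto_sphDecay_div_atTop`); it is the unique such solution up to a constant
(`eq_const_mul_sphDecay_of_tendsto`, `exists_eq_const_mul_sphDecay_of_tendsto`). At `λ = 2n + 2` the
second-kind function of row 441 decays (`tendsto_sphQ_div_sph_atTop`: `Q_n(cosh 2t) → 0` while
`φ_{2n+2}(a_t) ≥ 1`), hence by uniqueness and row 441's Wronskian

  **`Q_n(cosh 2t) = 2 χ_{2n+2}(t) = 2 P_n(cosh 2t) ∫_t^∞ ds/(sinh 2s · P_n(cosh 2s)²)`**  (`sphQ_eq_two_mul_sphDecay`),

the classical integral representation `Q_n(x) = P_n(x) ∫_x^∞ dy/((y² − 1) P_n(y)²)` in the variable `y = cosh 2s`.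
Nothing is claimed about (N).

Blind lane: Mathlib + the HodgeRepro2 prefix only; no sorry; axioms ⊆ {propext, Classical.choice,
Quot.sound}.
-/

namespace Summit.Ventures.HodgeRepro2.T5SU11SphericalDecay

open Filter Topology MeasureTheory
open Set (Ioi Ioc)
open T5SU11Cartan T5SU11SphericalFunction T5SU11SphericalBounds T5SU11SphericalAsymptotic T5SU11SphericalCfun
  T5SU11ReductionOfOrder T5SU11ReductionOfOrderInfinity T5SU11SphericalSolutionSpaceAll
  T5SU11SphericalSecondKind

/-! ### `sinh x ≥ e^x/4` for `x ≥ 1` -/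

/-- **`e^x/4 ≤ sinh x` for `x ≥ 1`.** -/
theorem exp_div_four_le_sinh {x : ℝ} (hx : 1 ≤ x) : Real.exp x / 4 ≤ Real.sinh x := by
  rw [Real.sinh_eq]
  have h1 : 2 ≤ Real.exp x := by
    have := Real.add_one_le_exp (1 : ℝ)
    have := Real.exp_le_exp.mpr hx
    linarith
  have h2 : Real.exp (-x) ≤ 1 := Real.exp_le_one_iff.mpr (by linarith)
  linarith

section measure

variable [MeasurableSpace Circle] [BorelSpace Circle]

/-! ### Integrability of the reduction-of-order integrand at infinity for `λ > 1` -/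

/-- For `λ > 1`: eventually `φ_λ(a_t) ≥ (c/2) e^{(λ−2)t}` with `c = c(2 − λ) > 0`. -/
theorem eventually_le_sph_hyp {lam : ℝ} (hlam : 1 < lam) :
    ∀ᶠ t in atTop, cfun (2 - lam) / 2 * Real.exp ((lam - 2) * t) ≤ sph lam (hyp t) := by
  have hc : 0 < cfun (2 - lam) := cfun_pos (by linarith)
  have h := (tendsto_exp_two_sub_mul_sph_hyp hlam).eventually (eventually_ge_nhds (half_lt_self hc))
  filter_upwards [h] with t ht
  have hE : 0 < Real.exp ((lam - 2) * t) := Real.exp_pos _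
  calc cfun (2 - lam) / 2 * Real.exp ((lam - 2) * t)
      ≤ (Real.exp ((2 - lam) * t) * sph lam (hyp t)) * Real.exp ((lam - 2) * t) :=
        mul_le_mul_of_nonneg_right ht hE.le
    _ = sph lam (hyp t) := by
        rw [mul_comm, ← mul_assoc, ← Real.exp_add, show (lam - 2) * t + (2 - lam) * t = 0 by ring, Real.exp_zero,
          one_mul]

/-- The pointwise exponential bound of the integrand: for `t ≥ 1` with `φ_λ(a_t) ≥ (c/2) e^{(λ−2)t}`,
`1/(sinh 2t φ_λ(a_t)²) ≤ (16/c²) e^{−2(λ−1)t}`. -/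
theorem roIntegrand_sph_le {lam c t : ℝ} (hc : 0 < c) (ht : 1 ≤ t)
    (hφ : c / 2 * Real.exp ((lam - 2) * t) ≤ sph lam (hyp t)) :
    roIntegrand (fun t => sph lam (hyp t)) t ≤ 16 / c ^ 2 * Real.exp (-(2 * (lam - 1)) * t) := by
  have hS : Real.exp (2 * t) / 4 ≤ Real.sinh (2 * t) := exp_div_four_le_sinh (by linarith)
  have hE : 0 < Real.exp ((lam - 2) * t) := Real.exp_pos _
  have hφ0 : 0 < sph lam (hyp t) := sph_hyp_pos lam t
  have hden : 0 < Real.sinh (2 * t) * sph lam (hyp t) ^ 2 :=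
    mul_pos (sinh_two_mul_pos (by linarith)) (pow_pos hφ0 2)
  have hlow : Real.exp (2 * t) / 4 * (c / 2 * Real.exp ((lam - 2) * t)) ^ 2
      ≤ Real.sinh (2 * t) * sph lam (hyp t) ^ 2 :=
    mul_le_mul hS (pow_le_pow_left₀ (by positivity) hφ 2) (by positivity) (sinh_two_mul_pos (by linarith)).le
  have key : Real.exp (-(2 * (lam - 1)) * t) * (Real.exp (2 * t) * Real.exp ((lam - 2) * t) ^ 2) = 1 := by
    rw [← Real.exp_nat_mul, ← Real.exp_add, ← Real.exp_add,
      show -(2 * (lam - 1)) * t + (2 * t + (2 : ℕ) * ((lam - 2) * t)) = 0 by push_cast; ring, Real.exp_zero]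
  show 1 / (Real.sinh (2 * t) * sph lam (hyp t) ^ 2) ≤ _
  rw [div_le_iff₀ hden]
  calc (1 : ℝ) = 16 / c ^ 2 * Real.exp (-(2 * (lam - 1)) * t)
        * (Real.exp (2 * t) / 4 * (c / 2 * Real.exp ((lam - 2) * t)) ^ 2) := by
        have e : 16 / c ^ 2 * Real.exp (-(2 * (lam - 1)) * t)
            * (Real.exp (2 * t) / 4 * (c / 2 * Real.exp ((lam - 2) * t)) ^ 2)
            = (16 / c ^ 2 * (c / 2) ^ 2 / 4)
              * (Real.exp (-(2 * (lam - 1)) * t) * (Real.exp (2 * t) * Real.exp ((lam - 2) * t) ^ 2)) := by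
          ring
        rw [e, key, mul_one]
        field_simp
        ring
    _ ≤ 16 / c ^ 2 * Real.exp (-(2 * (lam - 1)) * t) * (Real.sinh (2 * t) * sph lam (hyp t) ^ 2) :=
        mul_le_mul_of_nonneg_left hlow (by positivity)

/-- **The reduction-of-order integrand of `φ_λ` is integrable on `(1, ∞)` for `λ > 1`.** -/
theorem integrableOn_roIntegrand_sph {lam : ℝ} (hlam : 1 < lam) :
    IntegrableOn (roIntegrand fun t => sph lam (hyp t)) (Ioi 1) := by
  have hc : 0 < cfun (2 - lam) := cfun_pos (by linarith)
  obtain ⟨T₀, hT₀⟩ := eventually_atTop.mp (eventually_le_sph_hyp hlam)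
  set T := max T₀ 1 with hT
  have hT1 : 1 ≤ T := le_max_right _ _
  -- on `(1, T]`: continuity
  have h1 : IntegrableOn (roIntegrand fun t => sph lam (hyp t)) (Ioc 1 T) :=
    integrableOn_roIntegrand_Ioc (hφ_sph lam) (hpos_sph lam) one_pos
  -- on `(T, ∞)`: the exponential majorant
  have h2 : IntegrableOn (roIntegrand fun t => sph lam (hyp t)) (Ioi T) := by
    have hmaj : IntegrableOn (fun t => 16 / cfun (2 - lam) ^ 2 * Real.exp (-(2 * (lam - 1)) * t)) (Ioi T) :=
      (exp_neg_integrableOn_Ioi T (by linarith)).const_mul _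
    refine hmaj.mono' ?_ ?_
    · exact ((continuousOn_roIntegrand (hφ_sph lam) (hpos_sph lam)).mono
        (Set.Ioi_subset_Ioi (by linarith))).aestronglyMeasurable measurableSet_Ioi
    · refine ae_restrict_of_forall_mem measurableSet_Ioi (fun t ht => ?_)
      have ht' : T < t := ht
      have hg : 0 < roIntegrand (fun t => sph lam (hyp t)) t := by
        show 0 < 1 / (Real.sinh (2 * t) * sph lam (hyp t) ^ 2)
        exact div_pos one_pos (mul_pos (sinh_two_mul_pos (by linarith)) (pow_pos (sph_hyp_pos lam t) 2))
      rw [Real.norm_eq_abs, abs_of_pos hg]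
      exact roIntegrand_sph_le hc (by linarith) (hT₀ t (le_trans (le_max_left _ _) ht'.le))
  have := h1.union h2
  rwa [Set.Ioc_union_Ioi_eq_Ioi hT1] at this

/-! ### The decaying spherical solution -/

/-- **`χ_λ(t) = φ_λ(a_t) · ∫_t^∞ ds/(sinh 2s · φ_λ(a_s)²)`**, the decaying spherical solution. -/
noncomputable def sphDecay (lam t : ℝ) : ℝ := decaySolution (fun t => sph lam (hyp t)) t

/-- `χ_λ′`. -/
noncomputable def sphDecay' (lam t : ℝ) : ℝ :=
  decaySolution' (fun t => sph lam (hyp t)) (deriv fun t => sph lam (hyp t)) t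

/-- `χ_λ″`. -/
noncomputable def sphDecay'' (lam t : ℝ) : ℝ :=
  decaySolution'' (fun t => sph lam (hyp t)) (deriv fun t => sph lam (hyp t))
    (deriv (deriv fun t => sph lam (hyp t))) t

/-- `χ_λ = J φ_λ − ψ_λ` on `(0, ∞)`, `J = ∫_1^∞ ds/(sinh 2s φ_λ(a_s)²)`. -/
theorem sphDecay_eq {lam : ℝ} (hlam : 1 < lam) {t : ℝ} (ht : 0 < t) :
    sphDecay lam t = (∫ s in Ioi 1, roIntegrand (fun t => sph lam (hyp t)) s) * sph lam (hyp t)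
      - sphSecond lam t :=
  decaySolution_eq (hφ_sph lam) (hpos_sph lam) (integrableOn_roIntegrand_sph hlam) ht

/-- **`χ_λ > 0`** on `(0, ∞)`. -/
theorem sphDecay_pos {lam : ℝ} (hlam : 1 < lam) {t : ℝ} (ht : 0 < t) : 0 < sphDecay lam t :=
  decaySolution_pos (hφ_sph lam) (hpos_sph lam) (integrableOn_roIntegrand_sph hlam) ht

/-- `χ_λ′` is the derivative of `χ_λ` on `(0, ∞)`. -/
theorem hasDerivAt_sphDecay {lam : ℝ} (hlam : 1 < lam) {t : ℝ} (ht : 0 < t) :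
    HasDerivAt (sphDecay lam) (sphDecay' lam t) t :=
  hasDerivAt_decaySolution (hφ_sph lam) (hpos_sph lam) (integrableOn_roIntegrand_sph hlam) ht

/-- `χ_λ″` is the derivative of `χ_λ′` on `(0, ∞)`. -/
theorem hasDerivAt_sphDecay' (lam : ℝ) {t : ℝ} (ht : 0 < t) :
    HasDerivAt (sphDecay' lam) (sphDecay'' lam t) t :=
  hasDerivAt_decaySolution' (hφ_sph lam) (hφ'_sph lam) (hpos_sph lam) ht

/-- **`χ_λ` solves the radial equation** on `(0, ∞)`. -/
theorem sphDecay_ode {lam : ℝ} (hlam : 1 < lam) {t : ℝ} (ht : 0 < t) :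
    Real.sinh (2 * t) * sphDecay'' lam t + 2 * Real.cosh (2 * t) * sphDecay' lam t
      = lam * (lam - 2) * Real.sinh (2 * t) * sphDecay lam t :=
  decaySolution_ode (hφ_sph lam) (hpos_sph lam) (integrableOn_roIntegrand_sph hlam) (hode_sph lam) ht

/-- **The Wronskian** `sinh 2t · (φ_λ χ_λ′ − φ_λ′ χ_λ) = −1`. -/
theorem wronskian_sphDecay {lam : ℝ} (hlam : 1 < lam) {t : ℝ} (ht : 0 < t) :
    Real.sinh (2 * t) * (sph lam (hyp t) * sphDecay' lam t
      - deriv (fun t => sph lam (hyp t)) t * sphDecay lam t) = -1 :=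
  wronskian_decaySolution (hφ_sph lam) (hpos_sph lam) (integrableOn_roIntegrand_sph hlam) ht

/-- **`χ_λ/φ_λ → 0` at infinity.** -/
theorem tendsto_sphDecay_div_atTop {lam : ℝ} (hlam : 1 < lam) :
    Tendsto (fun t => sphDecay lam t / sph lam (hyp t)) atTop (𝓝 0) :=
  tendsto_decaySolution_div_atTop (hφ_sph lam) (hpos_sph lam) (integrableOn_roIntegrand_sph hlam)

/-- **Uniqueness of the decaying solution**: a solution `u` of the radial equation on `(0, ∞)` with
`u/φ_λ → 0` at infinity is `−sinh 2 · (φ_λ(a_1) u′(1) − φ_λ′(1) u(1)) · χ_λ`. -/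
theorem eq_const_mul_sphDecay_of_tendsto {lam : ℝ} (hlam : 1 < lam) {u u' u'' : ℝ → ℝ}
    (hu : ∀ t, 0 < t → HasDerivAt u (u' t) t) (hu' : ∀ t, 0 < t → HasDerivAt u' (u'' t) t)
    (hode : ∀ t, 0 < t → Real.sinh (2 * t) * u'' t + 2 * Real.cosh (2 * t) * u' t
      = lam * (lam - 2) * Real.sinh (2 * t) * u t)
    (hdecay : Tendsto (fun t => u t / sph lam (hyp t)) atTop (𝓝 0)) {t : ℝ} (ht : 0 < t) :
    u t = -(Real.sinh 2 * (sph lam (hyp 1) * u' 1 - deriv (fun t => sph lam (hyp t)) 1 * u 1)) * sphDecay lam t :=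
  eq_const_mul_decaySolution_of_tendsto (hφ_sph lam) (hφ'_sph lam) (hpos_sph lam)
    (integrableOn_roIntegrand_sph hlam) (hode_sph lam) hu hu' hode hdecay ht

/-- Every solution with `u/φ_λ → 0` at infinity is a constant multiple of `χ_λ`. -/
theorem exists_eq_const_mul_sphDecay_of_tendsto {lam : ℝ} (hlam : 1 < lam) {u u' u'' : ℝ → ℝ}
    (hu : ∀ t, 0 < t → HasDerivAt u (u' t) t) (hu' : ∀ t, 0 < t → HasDerivAt u' (u'' t) t)
    (hode : ∀ t, 0 < t → Real.sinh (2 * t) * u'' t + 2 * Real.cosh (2 * t) * u' t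
      = lam * (lam - 2) * Real.sinh (2 * t) * u t)
    (hdecay : Tendsto (fun t => u t / sph lam (hyp t)) atTop (𝓝 0)) :
    ∃ c : ℝ, ∀ t, 0 < t → u t = c * sphDecay lam t :=
  ⟨_, fun _ ht => eq_const_mul_sphDecay_of_tendsto hlam hu hu' hode hdecay ht⟩

/-! ### `λ = 2n + 2`: the second-kind function is the decaying solution -/

/-- `Q_n(cosh 2t)/φ_{2n+2}(a_t) → 0` at infinity (`Q_n(cosh 2t) → 0`, `φ_{2n+2}(a_t) ≥ 1`). -/
theorem tendsto_sphQ_div_sph_atTop (n : ℕ) :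
    Tendsto (fun t => sphQ n t / sph (2 * (n : ℝ) + 2) (hyp t)) atTop (𝓝 0) := by
  have h2 : (2 : ℝ) ≤ 2 * (n : ℝ) + 2 := by linarith [(Nat.cast_nonneg n : (0 : ℝ) ≤ n)]
  refine tendsto_of_tendsto_of_tendsto_of_le_of_le' tendsto_const_nhds (tendsto_sphQ_atTop n) ?_ ?_
  · filter_upwards [eventually_gt_atTop 0] with t ht
    exact (div_pos (sphQ_pos n ht.ne') (sph_hyp_pos _ t)).le
  · filter_upwards [eventually_gt_atTop 0] with t ht
    exact div_le_self (sphQ_pos n ht.ne').le (one_le_sph_hyp_of_two_le h2 t)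

/-- **`Q_n(cosh 2t) = 2 χ_{2n+2}(t)`** on `(0, ∞)`: the Legendre function of the second kind IS twice the decaying
spherical solution — the integral representation `Q_n(cosh 2t) = 2 P_n(cosh 2t) ∫_t^∞ ds/(sinh 2s P_n(cosh 2s)²)`. -/
theorem sphQ_eq_two_mul_sphDecay (n : ℕ) {t : ℝ} (ht : 0 < t) :
    sphQ n t = 2 * sphDecay (2 * (n : ℝ) + 2) t := by
  have hlam : (1 : ℝ) < 2 * (n : ℝ) + 2 := by linarith [(Nat.cast_nonneg n : (0 : ℝ) ≤ n)]
  have h := eq_const_mul_sphDecay_of_tendsto hlam (fun t ht => hasDerivAt_sphQ n ht.ne')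
    (fun t ht => hasDerivAt_sphQ' n ht.ne') (fun t ht => sphQ_ode n ht.ne') (tendsto_sphQ_div_sph_atTop n) ht
  have hW := wronskian_sphQ n (one_ne_zero : (1 : ℝ) ≠ 0)
  have hS : Real.sinh (2 * 1) ≠ 0 := (sinh_two_mul_pos one_pos).ne'
  have hb : -(Real.sinh 2 * (sph (2 * (n : ℝ) + 2) (hyp 1) * sphQ' n 1
      - deriv (fun t => sph (2 * (n : ℝ) + 2) (hyp t)) 1 * sphQ n 1)) = 2 := by
    rw [deriv_sph_even_hyp_one, hW]
    norm_num
    field_simp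
  rw [h, hb]

end measure

end Summit.Ventures.HodgeRepro2.T5SU11SphericalDecay
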